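import Summits.Schanuel.Schanuel.Theorems.RootDecomp1KGeneric11

/-!
# RootDecomp1K — «GENERIC CELLS», part 13: FINITE EXPONENTIAL ORDER — `LiouvilleOrder`, the size budget `Λ ≤ q⁷`, Piece NW at finite order

Provenance: ROOT DECOMPOSITION CELL decomp-schanuel (D-0178), lens 6 «barrier-complement carving»,
gen 13, Stage E «FINITE ORDER»; source `ORD.lean` (lens publication dir `decomp-schanuel-lens-6/g13/addendum/`).
Supports `stmt-Schanuel-33363` (A₄ʰ) AND carves item `stmt-Schanuel-33364` (A₄ᵈ `FiniteOrderLiouvilleSchanuel`):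
the pieces KS and CF of parts 05–11 only ever use ONE good rational approximation of the ratio `ρ`, so they
hold for reals of a FIXED exponential Liouville order — hyper-Liouville or not — and NW96 Thm 1 closes the
cell as soon as that order exceeds the exponent of its pair measure.  Sorry-free; standard axioms; nothing
here proves Schanuel (rung 0).

Contents: §1 `LiouvilleOrder k ρ` and its API (`of_hyperLiouville`, `mono`, `neg`, `liouville`, `irrational`,
`ne_zero`); §2 `budget_pairSize_seven`; §3 `PairApproxOrd`, `not_pairApproxOrd_of_NW` (quality `exp(−q^{43})`
against size `q⁷` contradicts NW96 Thm 1).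
-/

noncomputable section

open Complex Polynomial

namespace Summit.Schanuel.Schanuel.Theorems.RootDecomp1KGeneric

open Summit.Schanuel.Schanuel.Theorems.RootDecomp1KHyper
open Summit.Schanuel.Schanuel.Theorems.RootDecomp1KHyper.HyperCell

/-! ## ORD 1. Liouville numbers of finite EXPONENTIAL order

The hypothesis of A₄ᵈ (`FiniteOrderLiouvilleSchanuel`, item 33364) is: Liouville as a linear form to every
POLYNOMIAL order, but NOT to every exponential order.  The ratios treated here have a FIXED exponential
order `k` (infinitely many `p/q` with `|ρ − p/q| < exp(−q^k)`), hyper-Liouville or not. -/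

/-- `ρ` has EXPONENTIAL LIOUVILLE ORDER (at least) `k`: rationals `r` of arbitrarily large denominator with
`|ρ − r| < exp(−den(r)^k)`.  `HyperLiouville ρ` gives every order (`LiouvilleOrder.of_hyperLiouville`);
a real of order `k` and not of order `k + 1` is Liouville but not hyper-Liouville. -/
def LiouvilleOrder (k : ℕ) (ρ : ℝ) : Prop :=
  ∀ N : ℕ, ∃ r : ℚ, N ≤ r.den ∧ ρ ≠ r ∧ |ρ - r| < Real.exp (-((r.den : ℝ) ^ k))

/-- A hyper-Liouville real has every finite exponential Liouville order `k`. -/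
theorem LiouvilleOrder.of_hyperLiouville {ρ : ℝ} (h : HyperLiouville ρ) (k : ℕ) :
    LiouvilleOrder k ρ := by
  intro N
  obtain ⟨r, hden, hne, hlt⟩ := h (max N k)
  refine ⟨r, (le_max_left N k).trans hden, hne, hlt.trans_le ?_⟩
  rw [Real.exp_le_exp, neg_le_neg_iff]
  have hd1 : (1 : ℝ) ≤ r.den := by exact_mod_cast r.den_pos
  exact pow_le_pow_right₀ hd1 (le_max_right N k)

/-- Exponential Liouville order is monotone: order `k` implies order `j` for `j ≤ k`. -/
theorem LiouvilleOrder.mono {ρ : ℝ} {j k : ℕ} (h : LiouvilleOrder k ρ) (hjk : j ≤ k) :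
    LiouvilleOrder j ρ := by
  intro N
  obtain ⟨r, hden, hne, hlt⟩ := h N
  refine ⟨r, hden, hne, hlt.trans_le ?_⟩
  rw [Real.exp_le_exp, neg_le_neg_iff]
  have hd1 : (1 : ℝ) ≤ r.den := by exact_mod_cast r.den_pos
  exact pow_le_pow_right₀ hd1 hjk

/-- Exponential Liouville order `k` is stable under `ρ ↦ −ρ`. -/
theorem LiouvilleOrder.neg {ρ : ℝ} {k : ℕ} (h : LiouvilleOrder k ρ) : LiouvilleOrder k (-ρ) := by
  intro N
  obtain ⟨r, hden, hne, hlt⟩ := h N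
  refine ⟨-r, by rwa [Rat.neg_den], fun h' => hne (by rw [Rat.cast_neg] at h'; linarith), ?_⟩
  rw [Rat.neg_den, Rat.cast_neg, show -ρ - -(r : ℝ) = -(ρ - r) by ring, abs_neg]
  exact hlt

/-- Exponential order `≥ 3` implies Liouville (hence irrational and transcendental). -/
theorem LiouvilleOrder.liouville {ρ : ℝ} {k : ℕ} (h : LiouvilleOrder k ρ) (hk : 3 ≤ k) :
    Liouville ρ := by
  intro n
  obtain ⟨r, hden, hne, hlt⟩ := h (n + 2)
  have hd2 : 2 ≤ r.den := le_trans (by omega) hden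
  have hnd : n ≤ r.den := le_trans (by omega) hden
  have hd1 : (1 : ℝ) ≤ r.den := by exact_mod_cast r.den_pos
  have hr : (r : ℝ) = (r.num : ℝ) / ((r.den : ℤ) : ℝ) := by
    rw [Int.cast_natCast]; exact Rat.cast_def r
  refine ⟨r.num, r.den, by exact_mod_cast hd2, hr ▸ hne, ?_⟩
  rw [← hr]
  refine hlt.trans_le ?_
  rw [Real.exp_neg, Int.cast_natCast, ← one_div]
  refine one_div_le_one_div_of_le (by positivity) ?_
  calc ((r.den : ℝ)) ^ n ≤ (r.den : ℝ) ^ (n * r.den) :=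
        pow_le_pow_right₀ hd1 (Nat.le_mul_of_pos_right n r.den_pos)
    _ ≤ Real.exp ((r.den : ℝ) ^ 3) := pow_mul_le_exp_pow hnd le_rfl
    _ ≤ Real.exp ((r.den : ℝ) ^ k) := by
        rw [Real.exp_le_exp]; exact pow_le_pow_right₀ hd1 hk

/-- A real of exponential Liouville order `k ≥ 3` is irrational. -/
theorem LiouvilleOrder.irrational {ρ : ℝ} {k : ℕ} (h : LiouvilleOrder k ρ) (hk : 3 ≤ k) :
    Irrational ρ :=
  (h.liouville hk).irrational

/-- A real of exponential Liouville order `k ≥ 3` is nonzero. -/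
theorem LiouvilleOrder.ne_zero {ρ : ℝ} {k : ℕ} (h : LiouvilleOrder k ρ) (hk : 3 ≤ k) : ρ ≠ 0 :=
  (h.irrational hk).ne_zero

/-! ## ORD 2. The size budget with a FIXED exponent: `Λ(f, S) ≤ q⁷` past a tuple-dependent threshold -/

/-- The size of the output pair is `≤ q⁷` as soon as `q` exceeds the constant
`c² L (c + 2E + 2)(4cE + 2c + 1)` of the tuple (same inputs as `budget_pairSize`). -/
theorem budget_pairSize_seven {Q MS Mf MrA Mr1 RH : ℝ} {E L q c nA n₁ N dS df : ℕ}
    (hQ3 : 3 ≤ Q) (hQq : Q = q)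
    (hnA : nA ≤ c * q) (hn₁ : n₁ ≤ nA) (hN : N ≤ c * q) (hdS : dS ≤ nA) (hdf : df ≤ n₁ * L)
    (hMS1 : 1 ≤ MS) (hMS : MS ≤ 2 ^ nA * MrA ^ q) (hMrA1 : 1 ≤ MrA) (hMrA : MrA ≤ Q ^ (2 * E + 1))
    (hMf1 : 1 ≤ Mf) (hMf : Mf ≤ RH ^ n₁ * Mr1 ^ N) (hRH1 : 1 ≤ RH) (hRH : RH ≤ Q ^ (2 * E + 1))
    (hMr11 : 1 ≤ Mr1) (hMr1 : Mr1 ≤ MrA)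
    (hK : ((c ^ 2 * L * (c + 2 * E + 2) * (4 * c * E + 2 * c + 1) : ℕ) : ℝ) ≤ Q) :
    (((dS * df : ℕ) : ℝ)) * (1 + Real.log MS) * (1 + Real.log Mf) ≤ Q ^ 7 := by
  have hQ1 : (1 : ℝ) ≤ Q := by linarith
  have hQ0 : (0 : ℝ) < Q := by linarith
  have hQsq : Q ≤ Q ^ 2 := by nlinarith
  have h1Q2 : (1 : ℝ) ≤ Q ^ 2 := one_le_pow₀ hQ1
  have hc0 : (0 : ℝ) ≤ c := Nat.cast_nonneg c
  have hnAQ : (nA : ℝ) ≤ c * Q := by rw [hQq]; exact_mod_cast hnA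
  have hNQ : (N : ℝ) ≤ c * Q := by rw [hQq]; exact_mod_cast hN
  have hn₁Q : (n₁ : ℝ) ≤ c * Q := le_trans (by exact_mod_cast hn₁) hnAQ
  -- degrees
  have hdeg : (((dS * df : ℕ) : ℝ)) ≤ (c : ℝ) ^ 2 * L * Q ^ 2 := by
    have h1 : (dS : ℝ) ≤ c * Q := le_trans (by exact_mod_cast hdS) hnAQ
    have h2 : (df : ℝ) ≤ c * Q * L := by
      calc (df : ℝ) ≤ (n₁ : ℝ) * L := by exact_mod_cast hdf
        _ ≤ c * Q * L := by gcongr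
    push_cast
    calc (dS : ℝ) * df ≤ (c * Q) * (c * Q * L) := by gcongr
      _ = (c : ℝ) ^ 2 * L * Q ^ 2 := by ring
  -- logarithms
  have hlogQ : Real.log Q ≤ Q := by linarith [Real.log_le_sub_one_of_pos hQ0]
  have hMrA0 : 0 < MrA := by linarith
  have hMr10 : 0 < Mr1 := by linarith
  have hRH0 : 0 < RH := by linarith
  have hlogPow : Real.log (Q ^ (2 * E + 1)) ≤ (2 * E + 1) * Q := by
    rw [Real.log_pow]; push_cast; gcongr
  have hlMrA : Real.log MrA ≤ (2 * E + 1) * Q := (Real.log_le_log hMrA0 hMrA).trans hlogPow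
  have hlRH : Real.log RH ≤ (2 * E + 1) * Q := (Real.log_le_log hRH0 hRH).trans hlogPow
  have hlMr1 : Real.log Mr1 ≤ (2 * E + 1) * Q := (Real.log_le_log hMr10 hMr1).trans hlMrA
  have hlog2 : Real.log 2 ≤ 1 := by
    have := Real.log_le_sub_one_of_pos (show (0:ℝ) < 2 by norm_num); linarith
  have hlogS : 1 + Real.log MS ≤ ((c + 2 * E + 2 : ℕ) : ℝ) * Q ^ 2 := by
    have h1 : Real.log MS ≤ nA * Real.log 2 + q * Real.log MrA := by
      calc Real.log MS ≤ Real.log (2 ^ nA * MrA ^ q) := Real.log_le_log (by linarith) hMS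
        _ = nA * Real.log 2 + q * Real.log MrA := by
            rw [Real.log_mul (by positivity) (by positivity), Real.log_pow, Real.log_pow]
    have h2 : Real.log MS ≤ c * Q * 1 + Q * ((2 * E + 1) * Q) := by
      calc Real.log MS ≤ nA * Real.log 2 + q * Real.log MrA := h1
        _ ≤ c * Q * 1 + Q * ((2 * E + 1) * Q) := by
            rw [← hQq]
            have := Real.log_nonneg hMrA1
            gcongr
    have h3 : (c : ℝ) * Q ≤ c * Q ^ 2 := mul_le_mul_of_nonneg_left hQsq hc0
    have e1 : Q * ((2 * (E : ℝ) + 1) * Q) = (2 * E + 1) * Q ^ 2 := by ring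
    have e2 : ((c + 2 * E + 2 : ℕ) : ℝ) * Q ^ 2 = c * Q ^ 2 + (2 * E + 1) * Q ^ 2 + Q ^ 2 := by
      push_cast; ring
    rw [e2]
    linarith
  have hlogf : 1 + Real.log Mf ≤ ((4 * c * E + 2 * c + 1 : ℕ) : ℝ) * Q ^ 2 := by
    have h1 : Real.log Mf ≤ n₁ * Real.log RH + N * Real.log Mr1 := by
      calc Real.log Mf ≤ Real.log (RH ^ n₁ * Mr1 ^ N) := Real.log_le_log (by linarith) hMf
        _ = n₁ * Real.log RH + N * Real.log Mr1 := by
            rw [Real.log_mul (by positivity) (by positivity), Real.log_pow, Real.log_pow]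
    have h2 : Real.log Mf ≤ c * Q * ((2 * E + 1) * Q) + c * Q * ((2 * E + 1) * Q) := by
      calc Real.log Mf ≤ n₁ * Real.log RH + N * Real.log Mr1 := h1
        _ ≤ c * Q * ((2 * E + 1) * Q) + c * Q * ((2 * E + 1) * Q) := by
            gcongr <;> first | exact Real.log_nonneg hRH1 | exact Real.log_nonneg hMr11
    have e1 : (c : ℝ) * Q * ((2 * E + 1) * Q) + c * Q * ((2 * E + 1) * Q) =
        (4 * c * E + 2 * c) * Q ^ 2 := by ring
    have e2 : ((4 * c * E + 2 * c + 1 : ℕ) : ℝ) * Q ^ 2 = (4 * c * E + 2 * c) * Q ^ 2 + Q ^ 2 := by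
      push_cast; ring
    rw [e2]
    linarith
  have hlS0 : 0 ≤ 1 + Real.log MS := by linarith [Real.log_nonneg hMS1]
  have hlf0 : 0 ≤ 1 + Real.log Mf := by linarith [Real.log_nonneg hMf1]
  have hK' : (c : ℝ) ^ 2 * L * ((c + 2 * E + 2 : ℕ) : ℝ) * ((4 * c * E + 2 * c + 1 : ℕ) : ℝ) ≤ Q := by
    have h := hK; push_cast at h ⊢; linarith
  have hKnonneg : (0 : ℝ) ≤ (c : ℝ) ^ 2 * L * ((c + 2 * E + 2 : ℕ) : ℝ) *
      ((4 * c * E + 2 * c + 1 : ℕ) : ℝ) := by positivity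
  calc (((dS * df : ℕ) : ℝ)) * (1 + Real.log MS) * (1 + Real.log Mf)
      ≤ ((c : ℝ) ^ 2 * L * Q ^ 2) * (((c + 2 * E + 2 : ℕ) : ℝ) * Q ^ 2) *
          (((4 * c * E + 2 * c + 1 : ℕ) : ℝ) * Q ^ 2) := by gcongr
    _ = ((c : ℝ) ^ 2 * L * ((c + 2 * E + 2 : ℕ) : ℝ) * ((4 * c * E + 2 * c + 1 : ℕ) : ℝ)) *
          Q ^ 6 := by ring
    _ ≤ Q * Q ^ 6 := by gcongr
    _ = Q ^ 7 := by ring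

/-! ## ORD 3. Pair approximations of fixed size exponent, and the NW96 side -/

/-- Integer-polynomial simultaneous approximations of `(e^u, u)` of FIXED size exponent `7` and
quality `exp(−q^m)`, for `q` beyond every bound. -/
def PairApproxOrd (m : ℕ) (u : ℂ) : Prop :=
  ∀ N : ℕ, ∃ q : ℕ, N ≤ q ∧ ∃ (f S : ℤ[X]) (α β : ℂ), Irreducible f ∧ 0 < f.natDegree ∧ S ≠ 0 ∧
    aeval β f = 0 ∧ aeval α S = 0 ∧ α ≠ 0 ∧ β ≠ 0 ∧ pairSize f S ≤ (q : ℝ) ^ 7 ∧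
    ‖cexp u - α‖ + ‖u - β‖ < Real.exp (-((q : ℝ) ^ m))

/-- **Piece NW at finite order (kernel, mod NW96 Thm 1).**  No `u ≠ 0` has pair approximations of size
exponent `7` and quality `exp(−q^{43})`: `exp(−c (1 + q⁷)⁶) ≤ |e^u − α| + |u − β| < exp(−q^{43})` fails
for `q > 64 c`. -/
theorem not_pairApproxOrd_of_NW (hNW : Literature.NumberTheory.Transcendental.NesterenkoWaldschmidt1996_thm_1) {u : ℂ} (hu0 : u ≠ 0)
    {m : ℕ} (hm : 43 ≤ m) : ¬ PairApproxOrd m u := by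
  intro h
  set c : ℝ := cNW ‖u‖ with hcdef
  have hc0 : 0 < c := cNW_pos (norm_nonneg u)
  obtain ⟨q, hNq, f, S, α, β, hf, hfd, hS, hβ, hα, hα0, hβ0, hsize, hdist⟩ := h (⌈64 * c⌉₊ + 2)
  obtain ⟨hαalg, hβalg, hD1, hDle, hhα, hhβ⟩ := pair_bounds f hf hfd hβ S hS hα
  set MS : ℝ := (S.map (Int.castRingHom ℂ)).mahlerMeasure with hMSdef
  set Mf : ℝ := (f.map (Int.castRingHom ℂ)).mahlerMeasure with hMfdef
  have hlS0 : 0 ≤ Real.log MS := Real.log_nonneg (one_le_mahlerMeasure_of_ne_zero hS)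
  have hlf0 : 0 ≤ Real.log Mf := Real.log_nonneg (one_le_mahlerMeasure_of_ne_zero hf.ne_zero)
  set N₀ : ℕ := S.natDegree * f.natDegree with hN₀def
  have hDN : (Module.finrank ℚ ↥(IntermediateField.adjoin ℚ ({α, β} : Set ℂ)) : ℝ) ≤ N₀ := by
    exact_mod_cast hDle
  have hsz : pairSize f S = (N₀ : ℝ) * (1 + Real.log MS) * (1 + Real.log Mf) := rfl
  have hNsz : (N₀ : ℝ) ≤ pairSize f S := by
    rw [hsz]
    have : (N₀ : ℝ) * 1 * 1 ≤ (N₀ : ℝ) * (1 + Real.log MS) * (1 + Real.log Mf) := by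
      gcongr <;> linarith
    linarith
  have hSsz : Real.log MS ≤ pairSize f S := by
    rw [hsz]
    have : 1 * (1 + Real.log MS) * 1 ≤ (N₀ : ℝ) * (1 + Real.log MS) * (1 + Real.log Mf) := by
      gcongr
      · exact_mod_cast hD1.trans hDle
      · linarith
    linarith
  have hfsz : Real.log Mf ≤ pairSize f S := by
    rw [hsz]
    have : 1 * 1 * (1 + Real.log Mf) ≤ (N₀ : ℝ) * (1 + Real.log MS) * (1 + Real.log Mf) := by
      gcongr
      · exact_mod_cast hD1.trans hDle
      · linarith
    linarith
  have hq1 : (1 : ℝ) ≤ q := by exact_mod_cast (show 1 ≤ q by omega)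
  have hL1 : (1 : ℝ) ≤ (q : ℝ) ^ 7 := one_le_pow₀ hq1
  have hlow := expPair_lower_bound_of_NW1996Thm1 hNW hu0 hα0 hβ0 hαalg hβalg hL1
    (hDN.trans (hNsz.trans hsize)) (hhα.trans (hSsz.trans hsize)) (hhβ.trans (hfsz.trans hsize))
  have hlt := hlow.trans_lt hdist
  rw [Real.exp_lt_exp, neg_lt_neg_iff] at hlt
  have hqc : 64 * c < q := by
    have h1 : ((⌈64 * c⌉₊ + 2 : ℕ) : ℝ) ≤ q := by exact_mod_cast hNq
    push_cast at h1
    have h2 := Nat.le_ceil (64 * c)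
    linarith
  have h6 : (1 + (q : ℝ) ^ 7) ^ 6 ≤ (2 * (q : ℝ) ^ 7) ^ 6 :=
    pow_le_pow_left₀ (by positivity) (by linarith) 6
  have e6 : (2 * (q : ℝ) ^ 7) ^ 6 = 64 * (q : ℝ) ^ 42 := by
    rw [mul_pow, ← pow_mul]; norm_num
  have hqm : (q : ℝ) ^ 42 * q ≤ (q : ℝ) ^ m := by
    rw [← pow_succ]
    exact pow_le_pow_right₀ hq1 (by omega)
  have hup : c * (1 + (q : ℝ) ^ 7) ^ 6 ≤ 64 * c * (q : ℝ) ^ 42 := by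
    have := mul_le_mul_of_nonneg_left (h6.trans e6.le) hc0.le
    linarith
  have hlt2 : 64 * c * (q : ℝ) ^ 42 < (q : ℝ) ^ 42 * q := by
    rw [mul_comm ((q : ℝ) ^ 42) (q : ℝ)]
    exact mul_lt_mul_of_pos_right hqc (by positivity)
  linarith

end Summit.Schanuel.Schanuel.Theorems.RootDecomp1KGeneric
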